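import Summits.PneNP.PneNP.Theses.ConvexRankGates
import Literature.Computability.Complexity.ExtMonotoneCliqueGate
import Literature.Computability.Complexity.ExtMonotoneGRankSupport
import Literature.Computability.Complexity.CircuitLowerBoundsProofs

/-!
# `CliqueExtLowerBound` (stmt-PneNP-10682, route PneNP/ConvexRankGates) — negative-side lemmas: load-bearing hypotheses

Standing-adversary (cdisprove) output for the crux
`Summit.PneNP.PneNP.Theses.ConvexRankGates.CliqueExtLowerBound`:
`∃ δ ∈ (0,1/2), ∀ c, ∀ᶠ m, no circuit with ≤ m^c gates over B_{m^c} = {∧₂,∨₂} ∪ CONV_{m^c} ∪ PERM_{m^c} ∪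
GRANK_{m^c} computes CLIQUE(m, ⌈m^δ⌉₊)`. The crux is NOT refuted and NOT mis-stated; this file records,
as theorems, which parts of it any proof must use (gen-1 findings re-landed on the Literature modules
`ExtMonotoneCliqueGate` / `ExtMonotoneGRankSupport`, plus the gen-2 bridge):

* §0 `inlineExt_eq_extGate`, `cliqueExtLowerBound_iff` — the inline gate class IS `extGate`, the inline
  clique function IS `cliqueFn`; schedule form `LowerBoundAt k` (the crux is `∃ δ, LowerBoundAt ⌈m^δ⌉₊`).
* §1 `not_lowerBoundAt_of_choose_le` — if `C(m, k m) ≤ m^j` eventually, ONE LP gate (a CONV gate,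
  `CliqueLPGate.cliqueGate_isConvGate`, width ≤ m^{j+3}) computes CLIQUE(m, k m): the lower bound is FALSE
  for constant `k` (`not_lowerBoundAt_const`; the δ = 0 mutation `not_lowerBoundAt_delta_zero`), for
  `k = m - t` (`not_lowerBoundAt_sub_const`) and for `k = m` (δ = 1, `not_lowerBoundAt_delta_one`): any
  proof uses BOTH `⌈m^δ⌉₊ → ∞` and `m - ⌈m^δ⌉₊ → ∞`; the strengthening "∀ δ ∈ (0,1]" is false.
* §2 `cliqueExtLowerBound_false_without_width` — the CONV width bound `p + q ≤ s` is load-bearing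
  (fails at `c = 0` without it).
* §3 `cliqueExtLowerBound_false_without_size` — the size bound is load-bearing (monotone DNF).
* §4 `cliqueExtLowerBound_false_uniform` — the order `∀ c, ∀ᶠ m` is load-bearing: one `m₀` for all `c`
  is false.
* §5 `not_isConvGate'`, `not_not_mem_extGate` — `B ≥ 0` is exactly what keeps `¬` out of the basis
  (without it `¬` is a width-1 gate and the crux becomes a general circuit lower bound).
* §6 `grank_sees_every_clique` — the exact obligation of a GRANK-based kill: one GRANK gate computing
  CLIQUE(m,k), `k ≥ 2`, has for EVERY k-set `T` a θ-minor monomial whose wires read exactly `E(T)`.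

Companion: `PermSpanProgram.lean` (PERM universality; the PERM dimension bound is load-bearing too).
Refuter seats cdisprove-stmt-PneNP-10682 (gen 1) and -g2 (gen 2), 2026-08-15.
-/

namespace Summit.PneNP.PneNP.Theorems.CliqueExtLowerBound.Negative

open Literature.Computability.Complexity Literature.Computability.Complexity.CliqueLPGate Filter Finset
open Summit.PneNP.PneNP.Theses.ConvexRankGates (CliqueExtLowerBound)

/-! ## §0 Bridge: the inline gate class is `extGate`, the inline clique function is `cliqueFn` -/

/-- The gate class inlined (as a `let`) in the crux, copied verbatim. [folklore] -/
def inlineExt : ℕ → Set GateFn := fun s => {g | g = Literature.Computability.Complexity.GateFn.and 2 ∨ g = Literature.Computability.Complexity.GateFn.or 2 ∨ (∃ (p q : ℕ), p + q ≤ s ∧ ∃ (A : Fin p → Matrix (Fin q) (Fin q) ℝ) (b : Fin p → ℝ) (B : Fin p → Fin g.1 → ℝ), (∀ i j, 0 ≤ B i j) ∧ ∀ v : Fin g.1 → Bool, g.2 v = true ↔ ∃ Y : Matrix (Fin q) (Fin q) ℝ, Y.PosSemidef ∧ ∀ i, (A i * Y).trace ≤ b i + ∑ j, B i j * (if v j then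 (1 : ℝ) else 0)) ∨ (∃ d : ℕ, d ≤ s ∧ ∃ (σ : Fin g.1 → Equiv.Perm (Fin d)) (τ : Equiv.Perm (Fin d)), ∀ v : Fin g.1 → Bool, g.2 v = true ↔ τ ∈ Subgroup.closure (σ '' {i | v i = true})) ∨ (∃ (F : Type) (_ : Field F) (d θ : ℕ), d ≤ s ∧ ∃ (K₀ : Matrix (Fin d) (Fin d) F) (K : Fin g.1 → Matrix (Fin d) (Fin d) F), ∀ v : Fin g.1 → Bool, g.2 v = true ↔ θ ≤ (K₀.map (algebraMap F (FractionRing (MvPolynomial (Fin g.1) F))) + ∑ i, if v i then (algebraMap (MvPolynomial (Fin g.1) F) (FractionRing (MvPolynomial (Fin g.1) F)) (MvPolynomial.X i)) • (K i).map (algebraMap F (FractionRing (MvPolynomial (Fin g.1) F))) else 0).rank)}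

/-- The inline class is the Literature's extended monotone basis `extGate s`. [folklore] -/
theorem inlineExt_eq_extGate (s : ℕ) : inlineExt s = extGate s := by
  ext g
  rw [mem_extGate_iff]
  exact Iff.rfl

/-- Lower bound at an arbitrary clique-size schedule `k : ℕ → ℕ` (the crux is `∃ δ, LowerBoundAt ⌈m^δ⌉₊`).
[folklore] -/
def LowerBoundAt (k : ℕ → ℕ) : Prop :=
  ∀ c : ℕ, ∀ᶠ m : ℕ in atTop, ∀ C : Circuit ((⊤ : SimpleGraph (Fin m)).edgeSet),
    C.IsOver (extGate (m ^ c)) → C.size ≤ m ^ c → ¬ C.Computes (cliqueFn m (k m))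

open Classical in
/-- Read-back of the crux through the Literature API (gate class = `extGate`, function = `cliqueFn`).
[folklore] -/
theorem cliqueExtLowerBound_iff :
    CliqueExtLowerBound ↔ ∃ δ : ℝ, 0 < δ ∧ δ < 1 / 2 ∧ LowerBoundAt (fun m => ⌈(m : ℝ) ^ δ⌉₊) := by
  have key : ∀ s : ℕ, inlineExt s = extGate s := inlineExt_eq_extGate
  show (∃ δ : ℝ, 0 < δ ∧ δ < 1 / 2 ∧ ∀ c : ℕ, ∀ᶠ m : ℕ in atTop,
      ∀ C : Circuit ((⊤ : SimpleGraph (Fin m)).edgeSet), C.IsOver (inlineExt (m ^ c)) →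
        C.size ≤ m ^ c → ¬ C.Computes (cliqueFn m ⌈(m : ℝ) ^ δ⌉₊)) ↔ _
  simp only [key]
  rfl

/-! ## §1 Refuted schedules: `C(m, k m) ≤ m^j` eventually ⇒ the lower bound at `k` is FALSE -/

/-- **One LP gate kills every polynomially-enumerable schedule.** If `C(m, k m) ≤ m^j` for all large `m`,
then `LowerBoundAt k` fails: at `c = j + 3` the size-1 circuit whose gate is the LP/CONV gate of
`CliqueLPGate.cliqueGate_isConvGate` (width `≤ m^{j+3}`) computes `CLIQUE(m, k m)`. [folklore] -/
theorem not_lowerBoundAt_of_choose_le {k : ℕ → ℕ} {j : ℕ}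
    (h : ∀ᶠ m : ℕ in atTop, m.choose (k m) ≤ m ^ j) : ¬ LowerBoundAt k := by
  intro hLB
  obtain ⟨m, hm, hch, h3⟩ := ((hLB (j + 3)).and (h.and (eventually_ge_atTop 3))).exists
  obtain ⟨C, hC, hs, hc⟩ :=
    exists_oneGate_extGate_computes m (k m) (lpWidth_le_of_choose_le m (k m) j h3 hch)
  exact hm C hC (hs.trans (Nat.one_le_pow _ _ (by omega))) hc

/-- Constant clique size: `LowerBoundAt (fun _ => k)` is false for EVERY `k` (brute force is one LP gate of
width `≤ m^{k+3}`). [folklore] -/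
theorem not_lowerBoundAt_const (k : ℕ) : ¬ LowerBoundAt fun _ => k :=
  not_lowerBoundAt_of_choose_le (j := k) (Eventually.of_forall fun m => Nat.choose_le_pow m k)

/-- Co-constant clique size `k = m - t`: false for EVERY `t` (`C(m, m-t) = C(m, t) ≤ m^t`). [folklore] -/
theorem not_lowerBoundAt_sub_const (t : ℕ) : ¬ LowerBoundAt fun m => m - t := by
  refine not_lowerBoundAt_of_choose_le (j := t) ?_
  filter_upwards [eventually_ge_atTop t] with m hm
  rw [Nat.choose_symm hm]
  exact Nat.choose_le_pow m t

/-- The δ = 0 MUTATION is false: `⌈m^0⌉₊ = 1`, and CLIQUE(m,1) is one gate. So `0 < δ` is load-bearing.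
[folklore] -/
theorem not_lowerBoundAt_delta_zero : ¬ LowerBoundAt fun m => ⌈(m : ℝ) ^ (0 : ℝ)⌉₊ := by
  have : (fun m : ℕ => ⌈(m : ℝ) ^ (0 : ℝ)⌉₊) = fun _ => 1 := by
    funext m; simp
  rw [this]
  exact not_lowerBoundAt_const 1

/-- The δ = 1 endpoint is false: `⌈m^1⌉₊ = m` and CLIQUE(m,m) = ∧ of all edges is one gate. So the natural
strengthening "for every δ ∈ (0,1]" of the crux is FALSE; `m - ⌈m^δ⌉₊ → ∞` is used by any proof. [folklore] -/
theorem not_lowerBoundAt_delta_one : ¬ LowerBoundAt fun m => ⌈(m : ℝ) ^ (1 : ℝ)⌉₊ := by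
  have : (fun m : ℕ => ⌈(m : ℝ) ^ (1 : ℝ)⌉₊) = fun m => m - 0 := by
    funext m; simp
  rw [this]
  exact not_lowerBoundAt_sub_const 0

/-! ## §2 The width bound `p + q ≤ s` (and `d ≤ s`) is load-bearing -/

/-- **Any proof must use the width bound**: the crux with the CONV width bound `p + q ≤ s` dropped (CONV
gates of ANY width; everything else as filed) is false already at `c = 0` (one CONV gate of width
`C(m,k)·#E + 1 + C(m,k)` computes CLIQUE(m,k) for every m, k). [folklore] -/
theorem cliqueExtLowerBound_false_without_width :
    ¬ ∃ δ : ℝ, 0 < δ ∧ δ < 1 / 2 ∧ ∀ c : ℕ, ∀ᶠ m : ℕ in atTop,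
      ∀ C : Circuit ((⊤ : SimpleGraph (Fin m)).edgeSet),
        C.IsOver ({GateFn.and 2, GateFn.or 2} ∪
          {g | (∃ w, IsConvGate w g) ∨ IsPermGate (m ^ c) g ∨ IsGRankGate (m ^ c) g}) →
        C.size ≤ m ^ c → ¬ C.Computes (cliqueFn m ⌈(m : ℝ) ^ δ⌉₊) := by
  rintro ⟨δ, -, -, h⟩
  obtain ⟨m, hm, h1⟩ := ((h 0).and (eventually_ge_atTop 1)).exists
  obtain ⟨C, hC, hs, hc⟩ := exists_oneConvGate_computes m ⌈(m : ℝ) ^ δ⌉₊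
  refine hm C (hC.mono fun g hg => Or.inr (Or.inl ⟨_, hg⟩)) ?_ hc
  simpa using hs

/-! ## §3 The size bound is load-bearing -/

/-- `2 ≤ ⌈m^δ⌉₊` once `m ≥ 2` and `δ > 0`. [folklore] -/
theorem two_le_ceil_rpow {δ : ℝ} (hδ : 0 < δ) {m : ℕ} (hm : 2 ≤ m) : 2 ≤ ⌈(m : ℝ) ^ δ⌉₊ := by
  have h1 : (1 : ℝ) < (m : ℝ) ^ δ := Real.one_lt_rpow (by exact_mod_cast hm) hδ
  have : 1 < ⌈(m : ℝ) ^ δ⌉₊ := Nat.lt_ceil.2 (by exact_mod_cast h1)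
  omega

/-- `⌈m^δ⌉₊ ≤ m` once `m ≥ 1` and `δ ≤ 1`. [folklore] -/
theorem ceil_rpow_le {δ : ℝ} (hδ : δ ≤ 1) {m : ℕ} (hm : 1 ≤ m) : ⌈(m : ℝ) ^ δ⌉₊ ≤ m := by
  refine Nat.ceil_le.2 ?_
  calc (m : ℝ) ^ δ ≤ (m : ℝ) ^ (1 : ℝ) :=
        Real.rpow_le_rpow_of_exponent_le (by exact_mod_cast hm) hδ
    _ = m := Real.rpow_one _

/-- **Any proof must use the size bound**: the crux with `C.size ≤ m^c` dropped is false — CLIQUE(m,k) for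
`2 ≤ k ≤ m` is computed by its monotone DNF over `{∧₂, ∨₂} ⊆ B_s`
(`exists_monotone_computes_cliqueFn_holds`). [folklore] -/
theorem cliqueExtLowerBound_false_without_size :
    ¬ ∃ δ : ℝ, 0 < δ ∧ δ < 1 / 2 ∧ ∀ c : ℕ, ∀ᶠ m : ℕ in atTop,
      ∀ C : Circuit ((⊤ : SimpleGraph (Fin m)).edgeSet),
        C.IsOver (extGate (m ^ c)) → ¬ C.Computes (cliqueFn m ⌈(m : ℝ) ^ δ⌉₊) := by
  rintro ⟨δ, hδ0, hδ1, h⟩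
  obtain ⟨m, hm, h2⟩ := ((h 0).and (eventually_ge_atTop 2)).exists
  obtain ⟨C, hC, hc⟩ := exists_monotone_computes_cliqueFn_holds
    (two_le_ceil_rpow hδ0 h2) (ceil_rpow_le (by linarith) (by omega))
  exact hm C (hC.mono (monotoneBasis_subset_extGate _)) hc

/-! ## §4 The quantifier order `∀ c, ∀ᶠ m` is load-bearing -/

/-- **The quantifier order `∀ c, ∀ᶠ m` is load-bearing**: the version with ONE threshold `m₀` serving every
exponent `c` is false — at `m = max m₀ 3`, `k = ⌈m^δ⌉₊`, the exponent `c = k + 3` admits the LP gate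
(`lpWidth m k ≤ m^{k+3}`). [folklore] -/
theorem cliqueExtLowerBound_false_uniform :
    ¬ ∃ δ : ℝ, 0 < δ ∧ δ < 1 / 2 ∧ ∃ m₀ : ℕ, ∀ c : ℕ, ∀ m ≥ m₀,
      ∀ C : Circuit ((⊤ : SimpleGraph (Fin m)).edgeSet),
        C.IsOver (extGate (m ^ c)) → C.size ≤ m ^ c → ¬ C.Computes (cliqueFn m ⌈(m : ℝ) ^ δ⌉₊) := by
  rintro ⟨δ, -, -, m₀, h⟩
  set m := max m₀ 3 with hm
  have h3 : 3 ≤ m := le_max_right _ _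
  obtain ⟨C, hC, hs, hc⟩ := exists_oneGate_extGate_computes m ⌈(m : ℝ) ^ δ⌉₊
    (lpWidth_le m ⌈(m : ℝ) ^ δ⌉₊ h3)
  exact h (⌈(m : ℝ) ^ δ⌉₊ + 3) m (le_max_left _ _) C hC
    (hs.trans (Nat.one_le_pow _ _ (by omega))) hc

/-! ## §5 `B ≥ 0` is exactly what keeps negation out of the basis -/

/-- CONV gates with the sign condition on `B` dropped. [folklore] -/
def IsConvGate' (s : ℕ) (g : GateFn) : Prop :=
  ∃ p q : ℕ, p + q ≤ s ∧ ∃ (A : Fin p → Matrix (Fin q) (Fin q) ℝ) (b : Fin p → ℝ)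
    (B : Fin p → Fin g.1 → ℝ), ∀ v : Fin g.1 → Bool, g.2 v = true ↔
      ∃ Y : Matrix (Fin q) (Fin q) ℝ, Y.PosSemidef ∧
        ∀ i, (A i * Y).trace ≤ b i + ∑ j, B i j * (if v j then (1 : ℝ) else 0)

/-- Without `B ≥ 0`, `¬` is a width-1 "CONV" gate (`p = 1, q = 0, b = 0, B = -1`), so the mutated basis
contains the De Morgan basis and the mutated crux is a GENERAL circuit lower bound for CLIQUE. [folklore] -/
theorem not_isConvGate' : IsConvGate' 1 GateFn.not := by
  refine ⟨1, 0, le_rfl, fun _ => 0, fun _ => 0, fun _ _ => -1, fun v => ?_⟩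
  show (!(v (0 : Fin 1))) = true ↔ ∃ Y : Matrix (Fin 0) (Fin 0) ℝ, Y.PosSemidef ∧
    ∀ i : Fin 1, ((0 : Matrix (Fin 0) (Fin 0) ℝ) * Y).trace ≤
      (0 : ℝ) + ∑ j : Fin 1, (-1 : ℝ) * (if v j then (1 : ℝ) else 0)
  simp only [Matrix.zero_mul, Matrix.trace_zero, Fin.sum_univ_one, zero_add, Fin.forall_fin_one]
  constructor
  · intro hv
    refine ⟨0, Matrix.PosSemidef.zero, ?_⟩
    have : v (0 : Fin 1) = false := by simpa using hv
    simp [this]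
  · rintro ⟨Y, -, h0⟩
    cases hv : v (0 : Fin 1)
    · rfl
    · rw [hv] at h0
      norm_num at h0

/-- …whereas `¬ ∉ B_s` for every `s` (every extended gate is monotone). [folklore] -/
theorem not_not_mem_extGate (s : ℕ) : GateFn.not ∉ extGate s := by
  intro h
  have hmono := extGate_monotone h
  have hle : (fun _ : Fin 1 => false) ≤ (fun _ : Fin 1 => true) := fun _ => Bool.false_le _
  have := hmono hle
  revert this
  decide

/-! ## §6 The GRANK obligation: one GRANK gate for CLIQUE must see every clique as an exact support -/

section GRank

variable {m : ℕ}

/-- Two `k`-sets, `k ≥ 2`, whose induced edge sets are nested are equal. [folklore] -/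
theorem eq_of_edges_subset {k : ℕ} (hk : 2 ≤ k) {T T' : Finset (Fin m)} (hT : T.card = k)
    (hT' : T'.card = k)
    (h : ∀ e : (⊤ : SimpleGraph (Fin m)).edgeSet, (∀ y ∈ (e : Sym2 (Fin m)), y ∈ T') →
      ∀ y ∈ (e : Sym2 (Fin m)), y ∈ T) : T' = T := by
  refine Finset.eq_of_subset_of_card_le (fun v hv => ?_) (by rw [hT, hT'])
  obtain ⟨w, hw, hwv⟩ : ∃ w ∈ T', w ≠ v := by
    by_contra hno
    push Not at hno
    have : T' ⊆ {v} := fun w hw => Finset.mem_singleton.2 (hno w hw)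
    have := Finset.card_le_card this
    rw [hT', Finset.card_singleton] at this
    omega
  have he : s(v, w) ∈ (⊤ : SimpleGraph (Fin m)).edgeSet := by
    rw [SimpleGraph.mem_edgeSet]; exact hwv.symm
  refine h ⟨s(v, w), he⟩ (fun y hy => ?_) v (Sym2.mem_mk_left v w)
  rcases Sym2.mem_iff.1 hy with rfl | rfl
  · exact hv
  · exact hw

/-- **GRANK obligation.** If ONE GRANK gate `(F, d, θ, K₀, K)`, wired to the edge variables by `w`,
computes CLIQUE(m,k) with `k ≥ 2`, then for EVERY `k`-set `T` some `θ × θ` minor of the generic symbolic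
matrix `K₀ + ∑ Xᵢ Kᵢ` has a monomial whose wires read EXACTLY the edges inside `T` — all `C(m,k)` clique
supports must survive cancellation inside one `d × d` affine symbolic matrix. (By
`le_rank_symbolicMatrix_iff`: the gate accepts `x` iff some minor monomial has all its wires on.)
[folklore] -/
theorem grank_sees_every_clique {k n d θ : ℕ} (hk : 2 ≤ k) {F : Type*} [Field F]
    (K₀ : Matrix (Fin d) (Fin d) F) (K : Fin n → Matrix (Fin d) (Fin d) F)
    (w : Fin n → (⊤ : SimpleGraph (Fin m)).edgeSet)
    (hcomp : ∀ x : (⊤ : SimpleGraph (Fin m)).edgeSet → Bool,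
      cliqueFn m k x = true ↔ θ ≤ (symbolicMatrix K₀ K fun i => x (w i)).rank)
    (T : Finset (Fin m)) (hT : T.card = k) :
    ∃ (r c : Fin θ → Fin d), ∃ s ∈ (((symbolicPolyMatrix K₀ K).submatrix r c).det).support,
      ∀ e : (⊤ : SimpleGraph (Fin m)).edgeSet,
        (∃ i ∈ s.support, w i = e) ↔ ∀ y ∈ (e : Sym2 (Fin m)), y ∈ T := by
  classical
  -- the clique vector of `T` is accepted, through some minor monomial `s`
  set x : (⊤ : SimpleGraph (Fin m)).edgeSet → Bool := fun e => decide (∀ y ∈ (e : Sym2 (Fin m)), y ∈ T)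
  have hx : cliqueFn m k x = true :=
    (CliqueLPGate.cliqueFn_eq_true_iff_exists k x).2 ⟨T, hT, fun e he => by simpa [x] using he⟩
  obtain ⟨r, c, s, hs, hon⟩ := (le_rank_symbolicMatrix_iff K₀ K _ θ).1 ((hcomp x).1 hx)
  refine ⟨r, c, s, hs, fun e => ⟨?_, fun he => ?_⟩⟩
  · rintro ⟨i, hi, rfl⟩
    have := hon i hi
    simpa [x] using this
  · -- the sub-vector supported on the wires of `s` is accepted too, hence contains a k-clique `T' = T`
    set x' : (⊤ : SimpleGraph (Fin m)).edgeSet → Bool := fun e => decide (∃ i ∈ s.support, w i = e)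
    have hx' : cliqueFn m k x' = true :=
      (hcomp x').2 ((le_rank_symbolicMatrix_iff K₀ K _ θ).2 ⟨r, c, s, hs, fun i hi => by
        simp only [x', decide_eq_true_eq]; exact ⟨i, hi, rfl⟩⟩)
    obtain ⟨T', hT', hin⟩ := (CliqueLPGate.cliqueFn_eq_true_iff_exists k x').1 hx'
    have hsub : ∀ e : (⊤ : SimpleGraph (Fin m)).edgeSet, (∀ y ∈ (e : Sym2 (Fin m)), y ∈ T') →
        ∀ y ∈ (e : Sym2 (Fin m)), y ∈ T := by
      intro e' he'
      have h1 := hin e' he'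
      simp only [x', decide_eq_true_eq] at h1
      obtain ⟨i, hi, rfl⟩ := h1
      have := hon i hi
      simpa [x] using this
    have hTT : T' = T := eq_of_edges_subset hk hT hT' hsub
    subst hTT
    have h1 := hin e he
    simpa [x'] using h1

end GRank

end Summit.PneNP.PneNP.Theorems.CliqueExtLowerBound.Negative
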